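import Summits.ABC.ABC.Theorems.PrimePowerRadical.Negative.Orders
import Summits.ABC.ABC.Theorems.PrimePowerRadical.Negative.DoubleWall
import Summits.ABC.ABC.Theorems.PrimePowerRadical.Negative.LinearLoss

/-!
# `PrimePowerRadical` (stmt-ABC-1648), line `Sketch`: the Romanoff-type expectation theorem

For every base `q ≥ 2` the Brjuno weights `log p / ord_p(q)` are summable against the Wieferich
density `1/p`:

  `Σ_p log p / (p · ord_p(q)) < ∞`,

where `ord_p(q) = ordMod q p = orderOf (q : ZMod p)` (so `ord_p(q) = 0` and the summand is `0` for the
finitely many `p ∣ q`). This is the calibration `E[T_q] < ∞` of the independent `1/p` model behind the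
open stub `stub_wdc` of the line (Romanoff 1934 proved `Σ_p 1/(p · ord_p 2) < ∞`; Erdős–Turán 1935;
Murty–Rosen–Silverman 1996, "Variations on a theme of Romanoff").

Proof (elementary, no prime number theorem): split each prime `p` (with `d = ord_p(q) ≥ 1`) according to
the size of its order.
* LARGE order, `p ≤ d²`: then `d ≥ √p`, so `log p/(p·d) ≤ log p · p^{-3/2} ≤ 4·p^{-5/4}`
  (`log x ≤ 4 x^{1/4}`), a summable majorant over the primes (`rom_term_le_rpow`).
* SMALL order, `d² < p`: the partial sums are UNIFORMLY bounded (`rom_sum_small_order_le`): grouping a finite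
  set of such primes by the value `d` of the order, the primes of one fibre are distinct and all divide
  `q^d − 1`, so their log-mass is `≤ d·log q`, while each carries the weight `1/(p·d) ≤ 1/d³`; the fibre
  contributes `≤ log q/d²` (`rom_fibre_le`) and `Σ_d 1/d² < ∞`.
Assembling (`summable_of_sum_le`, `Summable.of_nonneg_of_le`) gives `stub_romanoff_log`.

Sources: card `adelic-brjuno-summability` (crux stmt-ABC-1648, line `Sketch`); the statement is the typed
stub `romanoff_log` of `Cruxes/PrimePowerRadical/SketchIdeator2g2.lean` (there left unproved), the
vocabulary (`ordMod`, `ordMod_pos`, `dvd_pow_sub_one_iff_ordMod_dvd`, `two_le_pow`) is that of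
`Negative/Orders.lean`. Deliberately NOT here: any asymptotics or explicit value of the sum, and the
other stubs of the line (`stub_wdc`, `stub_wieferichSparse_of_wdc`, …).
-/

noncomputable section

-- `Summit.<Summit>.<Problem>` is the mandated summit-side namespace (CONVENTIONS §2); for the
-- single-conjunct summit `ABC` the two coincide, so the duplicate `ABC.ABC` is deliberate.
set_option linter.dupNamespace false

namespace Summit.ABC.ABC.Theorems.PrimePowerRadical.Brjuno

open Literature.NumberTheory.DiophantineGeometry UniqueFactorizationMonoid
open Summit.ABC.ABC.Theses.IneffectiveSubspace
open Summit.ABC.ABC.Theorems.PrimePowerRadical.Negative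
open scoped BigOperators

/-- LARGE order (`d ≥ √p`): `log p/(p·d) ≤ 4·p^{-5/4}` for real `p ≥ 1`, `d ≥ 0` with `p ≤ d²`
(from `log p ≤ 4 p^{1/4}` and `p·d ≥ p^{3/2}`). [folklore] -/
theorem rom_term_le_rpow {p d : ℝ} (hp : 1 ≤ p) (hd : 0 ≤ d) (hpd : p ≤ d ^ 2) :
    Real.log p / (p * d) ≤ 4 * p ^ (-(5 / 4 : ℝ)) := by
  have hp0 : 0 < p := by linarith
  have hsqrt : √p ≤ d := (Real.sqrt_le_left hd).mpr hpd
  have hlog : Real.log p ≤ 4 * p ^ (1 / 4 : ℝ) := by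
    have h := Real.log_le_rpow_div hp0.le (by norm_num : (0 : ℝ) < 1 / 4)
    calc Real.log p ≤ p ^ (1 / 4 : ℝ) / (1 / 4) := h
      _ = 4 * p ^ (1 / 4 : ℝ) := by ring
  have hden : p ^ (3 / 2 : ℝ) ≤ p * d := by
    calc p ^ (3 / 2 : ℝ) = p * √p := by
          rw [show (3 / 2 : ℝ) = 1 + 1 / 2 by norm_num, Real.rpow_add hp0, Real.rpow_one,
            Real.sqrt_eq_rpow]
      _ ≤ p * d := mul_le_mul_of_nonneg_left hsqrt hp0.le
  calc Real.log p / (p * d) ≤ 4 * p ^ (1 / 4 : ℝ) / p ^ (3 / 2 : ℝ) :=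
        div_le_div₀ (by positivity) hlog (by positivity) hden
    _ = 4 * p ^ (-(5 / 4 : ℝ)) := by
        rw [mul_div_assoc, ← Real.rpow_sub hp0]
        norm_num

/-- SMALL order, one fibre: if every `p ∈ S` is a prime with `ord_p(q) = d ≥ 1` and `d² < p` (`q ≥ 2`),
then `Σ_{p ∈ S} log p/(p·ord_p(q)) ≤ log q/d²` — the primes of `S` are distinct and all divide
`q^d − 1`, so `Σ_{S} log p ≤ d·log q`, and each carries the weight `1/(p·d) ≤ 1/d³`. [folklore] -/
theorem rom_fibre_le {q d : ℕ} (hq : 2 ≤ q) (hd : 0 < d) (S : Finset ℕ)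
    (hS : ∀ p ∈ S, p.Prime ∧ ordMod q p = d ∧ d ^ 2 < p) :
    ∑ p ∈ S, Real.log p / ((p : ℝ) * (ordMod q p : ℝ)) ≤ Real.log q * (1 / (d : ℝ) ^ 2) := by
  have hdR : (0 : ℝ) < d := by exact_mod_cast hd
  -- the primes of the fibre are distinct and all divide `q^d - 1`
  have hn : 0 < q ^ d - 1 := by have := two_le_pow hq hd; omega
  have hdvd : ∏ p ∈ S, p ∣ q ^ d - 1 := by
    refine Finset.prod_primes_dvd (q ^ d - 1) (fun p hp => (hS p hp).1.prime) fun p hp => ?_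
    obtain ⟨hpr, hpd, -⟩ := hS p hp
    exact (dvd_pow_sub_one_iff_ordMod_dvd hpr (by omega) d).mpr (hpd ▸ dvd_rfl)
  have hprod_le : ((∏ p ∈ S, p : ℕ) : ℝ) ≤ (q : ℝ) ^ d := by
    have h : ∏ p ∈ S, p ≤ q ^ d := le_trans (Nat.le_of_dvd hn hdvd) (Nat.sub_le _ _)
    exact_mod_cast h
  have hprod_pos : (0 : ℝ) < ((∏ p ∈ S, p : ℕ) : ℝ) := by
    have h : 0 < ∏ p ∈ S, p := Finset.prod_pos fun p hp => (hS p hp).1.pos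
    exact_mod_cast h
  -- so the log-mass of the fibre is at most `d log q`
  have hlogsum : ∑ p ∈ S, Real.log p ≤ d * Real.log q := by
    have h1 : Real.log ((∏ p ∈ S, p : ℕ) : ℝ) = ∑ p ∈ S, Real.log p := by
      rw [Nat.cast_prod]
      exact Real.log_prod fun p hp => by exact_mod_cast (hS p hp).1.ne_zero
    rw [← h1, ← Real.log_pow]
    exact Real.log_le_log hprod_pos hprod_le
  -- termwise `log p/(p·d) ≤ log p/(d²·d)`
  have hterm : ∀ p ∈ S,
      Real.log p / ((p : ℝ) * (ordMod q p : ℝ)) ≤ Real.log p / ((d : ℝ) ^ 2 * d) := by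
    intro p hp
    obtain ⟨hpr, hpd, hdp⟩ := hS p hp
    rw [hpd]
    have hlog0 : 0 ≤ Real.log p := Real.log_nonneg (by exact_mod_cast hpr.one_lt.le)
    have hle : (d : ℝ) ^ 2 * d ≤ (p : ℝ) * d := by
      have h : ((d ^ 2 : ℕ) : ℝ) ≤ (p : ℝ) := by exact_mod_cast hdp.le
      push_cast at h
      exact mul_le_mul_of_nonneg_right h hdR.le
    exact div_le_div_of_nonneg_left hlog0 (by positivity) hle
  calc ∑ p ∈ S, Real.log p / ((p : ℝ) * (ordMod q p : ℝ))
      ≤ ∑ p ∈ S, Real.log p / ((d : ℝ) ^ 2 * d) := Finset.sum_le_sum hterm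
    _ = (∑ p ∈ S, Real.log p) / ((d : ℝ) ^ 2 * d) := by rw [Finset.sum_div]
    _ ≤ (d * Real.log q) / ((d : ℝ) ^ 2 * d) := div_le_div_of_nonneg_right hlogsum (by positivity)
    _ = Real.log q * (1 / (d : ℝ) ^ 2) := by
        field_simp

/-- SMALL order, uniformly: for every finite set `U` of primes `p` with `1 ≤ ord_p(q)` and `ord_p(q)² < p`
(`q ≥ 2`), `Σ_{p ∈ U} log p/(p·ord_p(q)) ≤ log q · Σ_n 1/n²` — group `U` by the value of the order and
add up the fibre bounds `rom_fibre_le`. [folklore] -/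
theorem rom_sum_small_order_le {q : ℕ} (hq : 2 ≤ q) (U : Finset ℕ)
    (hU : ∀ p ∈ U, p.Prime ∧ 0 < ordMod q p ∧ ordMod q p ^ 2 < p) :
    ∑ p ∈ U, Real.log p / ((p : ℝ) * (ordMod q p : ℝ)) ≤
      Real.log q * ∑' n : ℕ, 1 / (n : ℝ) ^ 2 := by
  have hlogq : 0 ≤ Real.log q := Real.log_nonneg (by exact_mod_cast (by omega : 1 ≤ q))
  have hfib : ∀ d ∈ U.image (ordMod q),
      ∑ p ∈ U with ordMod q p = d, Real.log p / ((p : ℝ) * (ordMod q p : ℝ)) ≤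
        Real.log q * (1 / (d : ℝ) ^ 2) := by
    intro d hd
    obtain ⟨p₀, hp₀, rfl⟩ := Finset.mem_image.mp hd
    refine rom_fibre_le hq (hU p₀ hp₀).2.1 _ fun p hp => ?_
    obtain ⟨hpU, hpd⟩ := Finset.mem_filter.mp hp
    exact ⟨(hU p hpU).1, hpd, hpd ▸ (hU p hpU).2.2⟩
  calc ∑ p ∈ U, Real.log p / ((p : ℝ) * (ordMod q p : ℝ))
      = ∑ d ∈ U.image (ordMod q), ∑ p ∈ U with ordMod q p = d,
          Real.log p / ((p : ℝ) * (ordMod q p : ℝ)) :=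
        (Finset.sum_fiberwise_of_maps_to (fun p hp => Finset.mem_image_of_mem _ hp) _).symm
    _ ≤ ∑ d ∈ U.image (ordMod q), Real.log q * (1 / (d : ℝ) ^ 2) := Finset.sum_le_sum hfib
    _ = Real.log q * ∑ d ∈ U.image (ordMod q), 1 / (d : ℝ) ^ 2 := by rw [Finset.mul_sum]
    _ ≤ Real.log q * ∑' n : ℕ, 1 / (n : ℝ) ^ 2 := by
        refine mul_le_mul_of_nonneg_left ?_ hlogq
        exact (Real.summable_one_div_nat_pow.mpr one_lt_two).sum_le_tsum _ fun n _ => by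
          positivity

/-- The small-order part `[p prime, 1 ≤ ord_p(q), ord_p(q)² < p] · log p/(p·ord_p(q))` is summable over `ℕ`:
its partial sums are uniformly bounded (`rom_sum_small_order_le`). [folklore] -/
theorem rom_summable_small_order {q : ℕ} (hq : 2 ≤ q) :
    Summable (fun n : ℕ =>
      if n.Prime ∧ 0 < ordMod q n ∧ ordMod q n ^ 2 < n
        then Real.log n / ((n : ℝ) * (ordMod q n : ℝ)) else 0) := by
  refine summable_of_sum_le (c := Real.log q * ∑' n : ℕ, 1 / (n : ℝ) ^ 2) (fun n => ?_) fun u => ?_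
  · dsimp only [Pi.zero_apply]
    split_ifs with h
    · exact div_nonneg (Real.log_nonneg (by exact_mod_cast h.1.one_lt.le)) (by positivity)
    · exact le_rfl
  · rw [← Finset.sum_filter]
    exact rom_sum_small_order_le hq _ fun p hp => (Finset.mem_filter.mp hp).2

/-- Pointwise majorant at a prime `p`:
`log p/(p·ord_p(q)) ≤ 4·p^{-5/4} + [1 ≤ ord_p(q), ord_p(q)² < p] · log p/(p·ord_p(q))`
(the summand vanishes when `ord_p(q) = 0`, i.e. `p ∣ q`; otherwise split by the size of the order and use
`rom_term_le_rpow` in the large-order case). [folklore] -/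
theorem rom_term_le (q : ℕ) (p : Nat.Primes) :
    Real.log p / ((p : ℝ) * (ordMod q p : ℝ)) ≤ 4 * (p : ℝ) ^ (-(5 / 4 : ℝ)) +
      (if (p : ℕ).Prime ∧ 0 < ordMod q p ∧ ordMod q p ^ 2 < (p : ℕ)
        then Real.log p / ((p : ℝ) * (ordMod q p : ℝ)) else 0) := by
  have hpr : (p : ℕ).Prime := p.2
  have hp1 : (1 : ℝ) ≤ (p : ℝ) := by exact_mod_cast hpr.one_lt.le
  have hA0 : 0 ≤ 4 * (p : ℝ) ^ (-(5 / 4 : ℝ)) := by positivity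
  rcases Nat.eq_zero_or_pos (ordMod q p) with h0 | hpos
  · -- `p ∣ q`: the summand is `log p / 0 = 0`
    rw [if_neg (by rintro ⟨-, h, -⟩; omega), h0, Nat.cast_zero, mul_zero, div_zero, add_zero]
    exact hA0
  · by_cases hlt : ordMod q p ^ 2 < (p : ℕ)
    · -- small order: the summand is the second majorant
      rw [if_pos ⟨hpr, hpos, hlt⟩]
      linarith
    · -- large order
      rw [if_neg fun h => hlt h.2.2, add_zero]
      exact rom_term_le_rpow hp1 (Nat.cast_nonneg _) (by exact_mod_cast not_lt.mp hlt)

/-- **Romanoff-type expectation theorem.** For every `q ≥ 2`,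
`Σ_p log p / (p · ord_p(q)) < ∞` (sum over all primes; `ord_p(q) = orderOf (q : ZMod p)`, the summand
being `0` for `p ∣ q`): the Brjuno weights `log p / ord_p(q)` are summable against the Wieferich density
`1/p`. Elementary proof by splitting at `p ≤ ord_p(q)²` (majorant `4 p^{-5/4}`) versus `ord_p(q)² < p`
(uniformly bounded partial sums, grouping the primes by their order). [Murty–Rosen–Silverman 1996,
"Variations on a theme of Romanoff"; Romanoff 1934] [folklore] -/
theorem stub_romanoff_log {q : ℕ} (hq : 2 ≤ q) :
    Summable (fun p : Nat.Primes => Real.log p / ((p : ℝ) * (ordMod q p : ℝ))) := by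
  have hA : Summable (fun p : Nat.Primes => 4 * (p : ℝ) ^ (-(5 / 4 : ℝ))) :=
    (Nat.Primes.summable_rpow.mpr (by norm_num)).mul_left 4
  have hB : Summable (fun p : Nat.Primes =>
      if (p : ℕ).Prime ∧ 0 < ordMod q p ∧ ordMod q p ^ 2 < (p : ℕ)
        then Real.log p / ((p : ℝ) * (ordMod q p : ℝ)) else 0) :=
    (rom_summable_small_order hq).subtype _
  refine Summable.of_nonneg_of_le (fun p => ?_) (fun p => rom_term_le q p) (hA.add hB)
  exact div_nonneg (Real.log_nonneg (by exact_mod_cast p.2.one_lt.le)) (by positivity)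

end Summit.ABC.ABC.Theorems.PrimePowerRadical.Brjuno

end
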